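import Literature.AlgebraicGeometry.Motives.HirschowitzIyerRuledSurfaceCycles
import Literature.AlgebraicGeometry.Motives.HirschowitzIyerRuledSurfaceVertical
import Literature.AlgebraicGeometry.Motives.HirschowitzIyerQuadricCubicGysin
import Literature.AlgebraicGeometry.Motives.HirschowitzIyerGysinInside
import Literature.AlgebraicGeometry.Motives.CyclesBirationalLiftProofs
import Literature.AlgebraicGeometry.Motives.GeneralisedDecompositionOfTheDiagonalProofs
import HarnessLib

/-!
# Hirschowitz–Iyer 2010, Lemma 2.2 (`s = 0`, `r = 1`) for `V₊(Q, C) ⊂ V₊(Q) ⊂ ℙ⁸`, and the Main Theorem at `(8, 1, 2, (2, 3))`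

Hirschowitz–Iyer 2010, Lemma 2.2 (`s = 0 < r = 1`): for a curve `W ⊆ Y = V₊(Q, C)` there are a
`2`-cycle `Γ` on `Y' = V₊(Q)` and `α > 0` with `Γ · Y ≡ α W` modulo curves spanned by strong lines.
Printed proof: `Γ := pr_{2*}(H'_Z)` for the ruled surface `H'_Z → Z` of strong lines through `W`;
"applying the projection formula to `pr₂ : Z × Y' → Y'`: `Γ · Y = pr_{2*}(H'_Z · (Z × Y))`";
"`H'_Z · (Z × Y) = d H_Z + ψ⁻¹(D)`"; "Since `H_Z` is generically finite over `W` and since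
`pr_{2*}(ψ⁻¹(D))` lies in `QCH^{(s+1)}_r(Y)`, one obtains, for some positive multiple `α` of `d`,
the relation `Γ · Y ≡ α W mod QCH^{(s+1)}_r(Y)`."

This file assembles exactly that from the tree: the ruled surface `S` with `π : S → V₊(Q)`
(`Motives/HirschowitzIyerRuledSurface`), its hyperplane section `E = H_m · [S]` and the principal
divisor `[σ̃] - [τ̃] = [div g̃]` along the generic fibre (`Motives/HirschowitzIyerRuledSurfaceCycles`),
the vertical fibres being strong lines (`Motives/HirschowitzIyerRuledSurfaceVertical`), the
projection formula (`CartierDivisor.map_primeInter_pullbackRep_sub_smul_mem`), Fulton's Thm. 1.4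
(`map_mem_ratTrivialOn_image`) and the excess Gysin computation inside `V₊(C)`
(`quadricCubicGysin_mk_primeCycle_eq_smul_of_closure_subset`) — giving the hypothesis `hcurves` of
`quadricCubicGysin_qsurjective_of_curves` (`Motives/HirschowitzIyerSurjectivity`), hence the
hypothesis `hsurj` of `HirschowitzIyer2010_QCH1_quadricCubic_P8_of_gysin_surjective`, hence

* `HirschowitzIyer2010_QCH1_quadricCubic_P8_holds` — **the Main Theorem of Hirschowitz–Iyer 2010 at
  `(n, r, s, (d₁, d₂)) = (8, 1, 2, (2, 3))`** (`Motives/HirschowitzIyerQuadricCubic`).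

## References

* A. Hirschowitz, J. N. N. Iyer, *Hilbert schemes of fat r-planes and the triviality of Chow groups
  of complete intersections*, Contemp. Math. 522 (2010), doi:10.1090/conm/522/10291,
  arXiv:0903.5018: §2 Lemma 2.2 and Theorem 2.1, §1.4, §1.6, §6 Prop. 6.1. [HirschowitzIyer2010]
* W. Fulton, *Intersection Theory* (1998), §1.4 Thm. 1.4, Prop. 2.3 (c), Example 2.4.3. [Fulton1998]
-/

noncomputable section

open CategoryTheory CategoryTheory.Limits AlgebraicGeometry Order MonoidalCategory IsLocalRing MvPolynomial
  TopologicalSpace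
open Literature.AlgebraicGeometry.Motives.Segre

universe u

namespace Literature.AlgebraicGeometry.Motives

attribute [local instance] MvPolynomial.gradedAlgebra

namespace GenericStrongLine

open ProjBaseChangeRing StrongLineCover

variable {K : Type u} [Field K] [IsAlgClosed K] {Q C : MvPolynomial (Fin (8 + 1)) K}
  {w : ↥(quadricCubic Q C).left} (𝔏 : GenericStrongLine Q C w) [IsIntegral (quadric Q).left]
  (hC : C ∈ grading (Fin (8 + 1)) K 3) (hC0 : C ≠ 0)
  (hCη : C ∉ (quadricι Q (genericPoint (quadric Q).left)).asHomogeneousIdeal)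

/-! ### Push-forwards along `π : S → V₊(Q)` -/

/-- `S` is compact. [folklore] -/
instance compactSpace_S : CompactSpace (𝔏.S).carrier := by
  haveI : IsProper ((projectiveSpace 8 K) ⊗ 𝔏.Z).hom := isProper_tensor_paramCurve_hom w (𝔏.F' : Type u)
  haveI : QuasiCompact ((projectiveSpace 8 K) ⊗ 𝔏.Z).hom := inferInstance
  haveI : CompactSpace ↥(Spec (CommRingCat.of K)) := inferInstanceAs (CompactSpace (PrimeSpectrum K))
  haveI : CompactSpace ↥((projectiveSpace 8 K) ⊗ 𝔏.Z).left :=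
    QuasiCompact.compactSpace_of_compactSpace ((projectiveSpace 8 K) ⊗ 𝔏.Z).hom
  exact (𝔏.S).ι.isClosedEmbedding.compactSpace

/-- `S → Spec K` is proper. [folklore] -/
instance isProper_So_hom : IsProper (𝔏.So).hom := by
  haveI : IsProper ((projectiveSpace 8 K) ⊗ 𝔏.Z).hom := isProper_tensor_paramCurve_hom w (𝔏.F' : Type u)
  exact inferInstanceAs (IsProper ((𝔏.S).ι ≫ ((projectiveSpace 8 K) ⊗ 𝔏.Z).hom))

include hC hC0 hCη in
/-- Every point of `π(S)` comes from `Y = V₊(Q, C)`. [folklore] -/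
theorem exists_eq_πq (s : (𝔏.S).carrier) : ∃ y : ↥(quadricCubic Q C).left,
    (quadricCubicToQuadric Q C).left y = (𝔏.πq).left s := by
  have hmem := mem_range_quadricCubicToQuadric_of_mem (by norm_num : 0 < 3) hC hC0 hCη
    (x := (𝔏.πq).left s) (by
      have h := 𝔏.closure_quadricι_πq_subset s (subset_closure (Set.mem_singleton _))
      exact Set.singleton_subset_iff.mp ((ProjectiveSpectrum.mem_zeroLocus _ _ _).mp h))
  exact hmem

include hC hC0 hCη in
/-- The image of `π` lies in the image of `Y ↪ V₊(Q)`. [folklore] -/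
theorem range_πq_subset : Set.range (𝔏.πq).left ⊆ Set.range (quadricCubicToQuadric Q C).left := by
  rintro _ ⟨s, rfl⟩
  obtain ⟨y, hy⟩ := 𝔏.exists_eq_πq hC hC0 hCη s
  exact ⟨y, hy⟩

include hC hC0 hCη in
/-- Closures of points of `π(S)` lie in the image of `Y`. [folklore] -/
theorem closure_πq_subset (s : (𝔏.S).carrier) :
    closure {(𝔏.πq).left s} ⊆ Set.range (quadricCubicToQuadric Q C).left := by
  refine closure_minimal (Set.singleton_subset_iff.mpr (𝔏.range_πq_subset hC hC0 hCη ⟨s, rfl⟩))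
    (quadricCubicToQuadric Q C).left.isClosedEmbedding.isClosed_range

include hC hC0 hCη in
/-- **Push-forward of a vertical prime divisor is a multiple of a strong line** (or zero).
[cite: HirschowitzIyer2010, §2 Lemma 2.2 (proof)] -/
theorem exists_map_primeCycle_vertical (hQ : Q.IsHomogeneous 2) (hC3 : C.IsHomogeneous 3) (hw : height w = 1)
    {s : (𝔏.S).carrier} (hs1 : height s = 1)
    (hs : (CartesianMonoidalCategory.snd (projectiveSpace 8 K) 𝔏.Z).left ((𝔏.S).ι s) ≠ genericPoint (𝔏.Z).left) :
    ∃ (ℓ : ↥(quadricCubic Q C).left) (_ : IsStrongLinePoint Q C 1 ℓ) (c : ℤ),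
      AlgebraicCycle.map (𝔏.πq).left height height (primeCycle s) =
        c • primeCycle ((quadricCubicToQuadric Q C).left ℓ) := by
  obtain ⟨ℓ, hℓ, hmem⟩ := 𝔏.exists_strongLine_of_vertical hQ hC3 hw hs
  refine ⟨ℓ, hℓ, ?_⟩
  rw [algebraicCycleMap_primeCycle_eq_nsmul]
  by_cases hcoef : AlgebraicCycle.mapCoeff (𝔏.πq).left height height s = 0
  · exact ⟨0, by rw [hcoef, zero_smul, zero_smul]⟩
  · -- heights agree, so `π s` is a line point of `Y` inside the strong line `ℓ`: `π s = ι ℓ`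
    have hheight : height s = height ((𝔏.πq).left s) := by
      by_contra h
      apply hcoef
      unfold AlgebraicCycle.mapCoeff
      split_ifs with h'
      · exact absurd h' h
      · rfl
    obtain ⟨y, hy⟩ := 𝔏.exists_eq_πq hC hC0 hCη s
    have hy1 : height y = 1 := by
      rw [← height_base_eq_of_isClosedImmersion' (quadricCubicToQuadric Q C).left y, hy, ← hheight, hs1]
    have hsub : closure {quadricι Q ((quadricCubicToQuadric Q C).left y)} ⊆
        closure {quadricι Q ((quadricCubicToQuadric Q C).left ℓ)} := by
      rw [hy]
      exact closure_minimal (Set.singleton_subset_iff.mpr hmem) isClosed_closure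
    have hyℓ : y = ℓ := eq_of_closure_subset_of_height_eq hy1 hℓ.1.height_eq hsub
    subst hyℓ
    refine ⟨(AlgebraicCycle.mapCoeff (𝔏.πq).left height height s : ℤ), ?_⟩
    rw [← hy, ← natCast_zsmul]

/-- The push-forward as an additive map. [folklore] -/
def pushHom : AlgebraicCycle (𝔏.S).carrier ℤ →+ AlgebraicCycle (quadric Q).left ℤ :=
  AddMonoidHom.mk' (AlgebraicCycle.map (𝔏.πq).left height height) (algebraicCycleMap_add (𝔏.πq).left height height)

omit [IsIntegral (quadric Q).left] in
/-- Unfolding. [folklore] -/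
@[simp] theorem pushHom_apply (c : AlgebraicCycle (𝔏.S).carrier ℤ) :
    𝔏.pushHom c = AlgebraicCycle.map (𝔏.πq).left height height c := rfl

include hC hC0 hCη in
open scoped Classical in
/-- **Push-forward of a vertical `1`-cycle is a combination of strong lines.**
[cite: HirschowitzIyer2010, §2 Lemma 2.2 (proof)] -/
theorem exists_sum_of_vertical (hQ : Q.IsHomogeneous 2) (hC3 : C.IsHomogeneous 3) (hw : height w = 1)
    (V : AlgebraicCycle (𝔏.S).carrier ℤ) (hV1 : V ∈ cyclesOfDim (𝔏.S).carrier 1)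
    (hVv : ∀ s, V s ≠ 0 →
      (CartesianMonoidalCategory.snd (projectiveSpace 8 K) 𝔏.Z).left ((𝔏.S).ι s) ≠ genericPoint (𝔏.Z).left) :
    ∃ (t : Finset ↥(quadricCubic Q C).left) (c : ↥(quadricCubic Q C).left → ℤ),
      (∀ v ∈ t, IsStrongLinePoint Q C 1 v) ∧
      AlgebraicCycle.map (𝔏.πq).left height height V =
        ∑ v ∈ t, c v • primeCycle ((quadricCubicToQuadric Q C).left v) := by
  set supp := (finite_support_of_compactSpace V).toFinset with hsupp
  have hsub : Function.support V ⊆ (supp : Set (𝔏.S).carrier) := by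
    intro s hs; simpa [hsupp] using hs
  have hmem : ∀ s ∈ supp, V s ≠ 0 := fun s hs => by simpa [hsupp] using hs
  -- choose strong lines for the points of the support
  have key : ∀ s : (𝔏.S).carrier, ∃ (ℓ : ↥(quadricCubic Q C).left) (c : ℤ), (s ∈ supp → IsStrongLinePoint Q C 1 ℓ) ∧
      (s ∈ supp → AlgebraicCycle.map (𝔏.πq).left height height (primeCycle s) =
        c • primeCycle ((quadricCubicToQuadric Q C).left ℓ)) := by
    intro s
    by_cases hs : s ∈ supp
    · have hs1 : height s = 1 := by exact_mod_cast hV1 s (hmem s hs)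
      obtain ⟨ℓ, hℓ, c, hc⟩ := 𝔏.exists_map_primeCycle_vertical hC hC0 hCη hQ hC3 hw hs1 (hVv s (hmem s hs))
      exact ⟨ℓ, c, fun _ => hℓ, fun _ => hc⟩
    · exact ⟨w, 0, fun h => absurd h hs, fun h => absurd h hs⟩
  choose ℓf cf hℓf hcf using key
  refine ⟨supp.image ℓf, fun v => ∑ s ∈ supp.filter (fun s => ℓf s = v), V s * cf s, ?_, ?_⟩
  · intro v hv
    obtain ⟨s, hs, rfl⟩ := Finset.mem_image.mp hv
    exact hℓf s hs
  · have hV : V = ∑ s ∈ supp, V s • primeCycle s := eq_sum_smul_primeCycle_of_support_subset V hsub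
    conv_lhs => rw [hV]
    rw [← pushHom_apply, map_sum]
    have h1 : ∑ s ∈ supp, 𝔏.pushHom (V s • primeCycle s) =
        ∑ s ∈ supp, (V s * cf s) • primeCycle ((quadricCubicToQuadric Q C).left (ℓf s)) := by
      refine Finset.sum_congr rfl fun s hs => ?_
      rw [map_zsmul, pushHom_apply]
      exact (congrArg (V s • ·) (hcf s hs)).trans (smul_smul _ _ _)
    rw [h1]
    symm
    rw [← Finset.sum_fiberwise_of_maps_to (g := ℓf) (fun s hs => Finset.mem_image_of_mem ℓf hs)]
    refine Finset.sum_congr rfl fun v hv => ?_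
    rw [Finset.sum_smul]
    refine Finset.sum_congr rfl fun s hs => ?_
    rw [(Finset.mem_filter.mp hs).2]

omit [IsIntegral (quadric Q).left] in
/-- `m` does not vanish at `π(η_S)`. [folklore] -/
theorem mK_notMem_πq_genericPoint : 𝔏.mK ∉ ProjectiveSpectrum.asHomogeneousIdeal
    (𝒜 := MvPolynomial.homogeneousSubmodule (Fin (8 + 1)) K) (quadricι Q ((𝔏.πq).left (genericPoint (𝔏.S).carrier))) := by
  intro h
  have hsp : quadricι Q ((𝔏.πq).left (genericPoint (𝔏.S).carrier)) ⤳
      quadricι Q ((𝔏.πq).left (σS w (𝔏.F' : Type u) 𝔏.lineData)) :=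
    (((genericPoint_spec (𝔏.S).carrier).specializes (Set.mem_univ _)).map (𝔏.πq).left.continuous).map
      (quadricι Q).continuous
  have h' := asHomogeneousIdeal_le_of_specializes hsp h
  rw [quadricι_πq, prS_σS] at h'
  exact 𝔏.mK_notMem_w h'

include hC hC0 hCη in
/-- **Lemma 2.2 at the level of cycles on `V₊(Q)`**: for the curve `W = closure {w}` there are
`N ≠ 0`, the `2`-cycle `Γ = [π(S)]` weighted by `deg(S/π(S))`, and strong lines `Lᵢ` with
`N [ι W] - deg • (H_m · Γ) - Σ cᵢ [ι Lᵢ]` rationally trivial on `V₊(Q)` along `ι(Y)`.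
[cite: HirschowitzIyer2010, §2 Lemma 2.2] -/
theorem relation_quadric (hQ : Q.IsHomogeneous 2) (hC3 : C.IsHomogeneous 3) (hw : height w = 1) :
    ∃ N : ℤ, N ≠ 0 ∧ ∃ (t : Finset ↥(quadricCubic Q C).left) (c : ↥(quadricCubic Q C).left → ℤ),
      (∀ v ∈ t, IsStrongLinePoint Q C 1 v) ∧
      N • primeCycle ((quadricCubicToQuadric Q C).left w) -
          ((AlgebraicCycle.mapCoeff (𝔏.πq).left height height (genericPoint (𝔏.S).carrier) : ℕ) : ℤ) •
            (𝔏.Hm).primeInter (X := quadric Q) ((𝔏.πq).left (genericPoint (𝔏.S).carrier)) -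
          ∑ v ∈ t, c v • primeCycle ((quadricCubicToQuadric Q C).left v) ∈
        ratTrivialOn (quadric Q).left (Set.range (quadricCubicToQuadric Q C).left) 1 := by
  set f := (𝔏.πq).left with hf
  set η := genericPoint (𝔏.S).carrier with hη
  set E := 𝔏.hyperplaneInter with hE
  set a : ℤ := E (τS w (𝔏.F' : Type u) 𝔏.lineData) with ha
  have ha0 : a ≠ 0 := (𝔏.hyperplaneInter_τS_pos hw).ne'
  -- the principal divisor along the generic fibre
  obtain ⟨g, hg0, hg⟩ := 𝔏.exists_ord_eq_horizontal
  haveI : IsLocallyNoetherian (𝔏.So).left := inferInstanceAs (IsLocallyNoetherian (𝔏.S).carrier)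
  set Dg : AlgebraicCycle (𝔏.S).carrier ℤ := (CartierDivisor.principal (X := (𝔏.So).left) g hg0).cycle with hDg
  have hDg_apply : ∀ s, Dg s = Scheme.ord g s := fun s =>
    congrFun (CartierDivisor.coe_cycle_principal (X := (𝔏.So).left) hg0) s
  have hS2 : height (⊤ : ↥(𝔏.So).left) = 1 + 1 := height_genericPoint_surf_carrier w (𝔏.F' : Type u) 𝔏.lineData hw
  have hDg_rat : Dg ∈ ratTrivial (𝔏.S).carrier 1 :=
    CartierDivisor.cycle_principal_mem_ratTrivial (V := 𝔏.So) hS2 hg0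
  -- heights
  have hE1 : E ∈ cyclesOfDim (𝔏.S).carrier 1 :=
    CartierDivisor.primeInter_mem_cyclesOfDim (X := 𝔏.So) _ (height_genericPoint_surf_carrier w (𝔏.F' : Type u) 𝔏.lineData hw)
  have hDg1 : Dg ∈ cyclesOfDim (𝔏.S).carrier 1 := ratTrivial_le_cyclesOfDim _ _ hDg_rat
  have hσ1 : primeCycle (σS w (𝔏.F' : Type u) 𝔏.lineData) ∈ cyclesOfDim (𝔏.S).carrier 1 :=
    primeCycle_mem_cyclesOfDim (height_σS w (𝔏.F' : Type u) 𝔏.lineData hw)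
  have hτ1 : primeCycle (τS w (𝔏.F' : Type u) 𝔏.lineData) ∈ cyclesOfDim (𝔏.S).carrier 1 :=
    primeCycle_mem_cyclesOfDim (height_τS w (𝔏.F' : Type u) 𝔏.lineData hw)
  -- the vertical part `Vtot = (E - a[τ̃]) + a (Dg - ([σ̃] - [τ̃]))`
  set Vtot : AlgebraicCycle (𝔏.S).carrier ℤ := (E - a • primeCycle (τS w (𝔏.F' : Type u) 𝔏.lineData)) +
    a • (Dg - (primeCycle (σS w (𝔏.F' : Type u) 𝔏.lineData) - primeCycle (τS w (𝔏.F' : Type u) 𝔏.lineData))) with hVtot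
  have hVtot1 : Vtot ∈ cyclesOfDim (𝔏.S).carrier 1 :=
    add_mem (sub_mem hE1 (AddSubgroup.zsmul_mem _ hτ1 _)) (AddSubgroup.zsmul_mem _ (sub_mem hDg1 (sub_mem hσ1 hτ1)) _)
  have hVtotv : ∀ s, Vtot s ≠ 0 →
      (CartesianMonoidalCategory.snd (projectiveSpace 8 K) 𝔏.Z).left ((𝔏.S).ι s) ≠ genericPoint (𝔏.Z).left := by
    intro s hs hhor
    apply hs
    simp only [hVtot, Function.locallyFinsuppWithin.coe_add, Function.locallyFinsuppWithin.coe_sub,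
      Function.locallyFinsuppWithin.coe_zsmul, Pi.add_apply, Pi.sub_apply, Pi.smul_apply, smul_eq_mul]
    rw [hDg_apply, hg s hhor]
    simp only [Function.locallyFinsuppWithin.coe_sub, Pi.sub_apply]
    by_cases hsτ : s = τS w (𝔏.F' : Type u) 𝔏.lineData
    · subst hsτ
      rw [primeCycle_apply_self, mul_one, ha, hE, sub_self, zero_add]
      ring
    · rw [hE, 𝔏.hyperplaneInter_apply_eq_zero_of_horizontal hw hhor hsτ, primeCycle_apply_of_ne hsτ]
      ring
  obtain ⟨t, c, ht, hmap⟩ := 𝔏.exists_sum_of_vertical hC hC0 hCη hQ hC3 hw Vtot hVtot1 hVtotv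
  -- the identity on `S`: `a [σ̃] = a Dg + E - Vtot`
  have hkey : a • primeCycle (σS w (𝔏.F' : Type u) 𝔏.lineData) = a • Dg + E - Vtot := by
    simp only [hVtot, smul_sub]
    abel
  -- the degree `N₀ = [κ(σ̃) : κ(w)] ≠ 0`
  set N₀ : ℕ := AlgebraicCycle.mapCoeff f height height (σS w (𝔏.F' : Type u) 𝔏.lineData) with hN₀
  have hN₀0 : (N₀ : ℤ) ≠ 0 := by
    have h := Scheme.height_eq_height_add_height_asFiber f (quadric Q).hom (σS w (𝔏.F' : Type u) 𝔏.lineData)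
    have h1 : height (σS w (𝔏.F' : Type u) 𝔏.lineData) = 1 := height_σS w (𝔏.F' : Type u) 𝔏.lineData hw
    have h2 : height (f (σS w (𝔏.F' : Type u) 𝔏.lineData)) = 1 := by
      rw [hf, πq_σS, height_base_eq_of_isClosedImmersion' (quadricCubicToQuadric Q C).left w, hw]
    erw [h1, h2] at h
    have hfib : height (f.asFiber (σS w (𝔏.F' : Type u) 𝔏.lineData)) = 0 := by
      by_contra hne
      have hpos : 1 ≤ height (f.asFiber (σS w (𝔏.F' : Type u) 𝔏.lineData)) := Order.one_le_iff_pos.mpr (pos_iff_ne_zero.mpr hne)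
      have hle : (1 : ℕ∞) + 1 ≤ 1 := by
        calc (1 : ℕ∞) + 1 ≤ 1 + height (f.asFiber (σS w (𝔏.F' : Type u) 𝔏.lineData)) := by gcongr
          _ = 1 := by exact_mod_cast h.symm
      exact absurd hle (by decide)
    have hres := residueDegree_ne_zero_of_height_asFiber_eq_zero f (σS w (𝔏.F' : Type u) 𝔏.lineData) hfib
    rw [hN₀, mapCoeff_height_eq_residueDegree f (quadric Q).hom]
    exact_mod_cast hres
  have hmapσ : 𝔏.pushHom (a • primeCycle (σS w (𝔏.F' : Type u) 𝔏.lineData)) =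
      (a * N₀) • primeCycle ((quadricCubicToQuadric Q C).left w) := by
    rw [map_zsmul, pushHom_apply]
    have h := algebraicCycleMap_primeCycle_eq_nsmul (𝔏.πq).left (σS w (𝔏.F' : Type u) 𝔏.lineData)
    refine (congrArg (a • ·) h).trans ?_
    rw [← natCast_zsmul, smul_smul, πq_σS]
  -- rational triviality of the pushed pieces
  have hrange := 𝔏.range_πq_subset hC hC0 hCη
  have hDg_push : 𝔏.pushHom Dg ∈ ratTrivialOn (quadric Q).left (Set.range (quadricCubicToQuadric Q C).left) 1 := by
    rw [pushHom_apply]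
    refine map_mem_ratTrivialOn_of_image_subset (X := 𝔏.So) (Y := quadric Q) 𝔏.πq ?_ (Z := Set.univ) ?_
    · rintro _ ⟨s, -, rfl⟩; exact hrange ⟨s, rfl⟩
    · rw [ratTrivialOn_univ]; exact hDg_rat
  have hE_push : 𝔏.pushHom E -
      ((AlgebraicCycle.mapCoeff f height height η : ℕ) : ℤ) • (𝔏.Hm).primeInter (X := quadric Q) (f η) ∈
      ratTrivialOn (quadric Q).left (Set.range (quadricCubicToQuadric Q C).left) 1 := by
    have h := CartierDivisor.map_primeInter_pullbackRep_sub_smul_mem (X' := 𝔏.So) (X := quadric Q) 𝔏.πq 𝔏.Hm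
      (z' := η) (d := 1) (height_genericPoint_surf_carrier w (𝔏.F' : Type u) 𝔏.lineData hw)
    refine ratTrivialOn_mono ?_ h
    exact (Set.inter_subset_left).trans (𝔏.closure_πq_subset hC hC0 hCη η)
  -- assemble
  refine ⟨a * N₀, mul_ne_zero ha0 hN₀0, t, fun v => -c v, ht, ?_⟩
  beta_reduce
  have hpush := congrArg 𝔏.pushHom hkey
  rw [hmapσ, map_sub, map_add, map_zsmul, pushHom_apply 𝔏 Vtot, hmap] at hpush
  have hfinal : (a * (N₀ : ℤ)) • primeCycle ((quadricCubicToQuadric Q C).left w) -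
      ((AlgebraicCycle.mapCoeff f height height η : ℕ) : ℤ) • (𝔏.Hm).primeInter (X := quadric Q) (f η) -
      ∑ v ∈ t, (-c v) • primeCycle ((quadricCubicToQuadric Q C).left v) =
      a • 𝔏.pushHom Dg + (𝔏.pushHom E -
        ((AlgebraicCycle.mapCoeff f height height η : ℕ) : ℤ) • (𝔏.Hm).primeInter (X := quadric Q) (f η)) := by
    rw [hpush]
    simp only [neg_smul, Finset.sum_neg_distrib]
    abel
  rw [hfinal]
  exact add_mem (AddSubgroup.zsmul_mem _ hDg_push _) hE_push

include 𝔏 hC hC0 hCη in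
/-- **Lemma 2.2 (`s = 0`, `r = 1`) in `CH₁(V₊(Q, C))`**: `N [W] = Γ · Y + Σ cᵢ [Lᵢ]` with `N ≠ 0`,
`Γ ∈ CH₂(V₊(Q))` and strong lines `Lᵢ` — the hypothesis `hcurves` of
`quadricCubicGysin_qsurjective_of_curves`. [cite: HirschowitzIyer2010, §2 Lemma 2.2] -/
theorem hcurve (hQ : Q.IsHomogeneous 2) (hC3 : C.IsHomogeneous 3) (hw : height w = 1) :
    ∃ N : ℤ, N ≠ 0 ∧
      ∃ (x : ChowGroup (quadric Q).left (1 + 1)) (t : Finset ↥(quadricCubic Q C).left)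
        (ht : ∀ v ∈ t, IsStrongLinePoint Q C 1 v) (c : ↥(quadricCubic Q C).left → ℤ),
        N • ChowGroup.ofPoint w hw =
          quadricCubicGysin (by norm_num : 0 < 3) hC hC0 hCη 1 x +
            ∑ v ∈ t.attach, c v • ChowGroup.ofPoint (v : ↥(quadricCubic Q C).left) (ht v v.2).1.height_eq := by
  obtain ⟨N, hN, t, c, ht, hrel⟩ := 𝔏.relation_quadric hC hC0 hCη hQ hC3 hw
  set i := (quadricCubicToQuadric Q C).left with hi
  set f := (𝔏.πq).left with hf
  set η := genericPoint (𝔏.S).carrier with hη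
  set m : ℤ := ((AlgebraicCycle.mapCoeff f height height η : ℕ) : ℤ) with hm
  set HmPI := (𝔏.Hm).primeInter (X := quadric Q) (f η) with hHmPI
  -- restrict to `Y`
  have hres := cycleRestrictClosed_mem_ratTrivial_of_mem_ratTrivialOn i hrel
  have hlin : cycleRestrictClosed i (N • primeCycle (i w) - m • HmPI - ∑ v ∈ t, c v • primeCycle (i v)) =
      N • primeCycle w - m • cycleRestrictClosed i HmPI - ∑ v ∈ t, c v • primeCycle v := by
    change cycleRestrictClosedHom i _ = _
    rw [map_sub, map_sub, map_zsmul, map_sum]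
    change cycleRestrictClosed i (N • primeCycle (i w)) - m • cycleRestrictClosed i HmPI -
      ∑ v ∈ t, cycleRestrictClosedHom i (c v • primeCycle (i v)) = _
    rw [cycleRestrictClosed_zsmul_primeCycle]
    congr 1
    refine Finset.sum_congr rfl fun v _ => ?_
    exact cycleRestrictClosed_zsmul_primeCycle (c v) v
  rw [hlin] at hres
  -- memberships in `Z₁(Y)`
  have hpw : primeCycle w ∈ cyclesOfDim (quadricCubic Q C).left 1 := primeCycle_mem_cyclesOfDim hw
  have hpv : ∀ v ∈ t, primeCycle v ∈ cyclesOfDim (quadricCubic Q C).left 1 := fun v hv => (ht v hv).1.primeCycle_mem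
  have hsum_mem : (∑ v ∈ t, c v • primeCycle v) ∈ cyclesOfDim (quadricCubic Q C).left 1 :=
    AddSubgroup.sum_mem _ fun v hv => AddSubgroup.zsmul_mem _ (hpv v hv) _
  have hsum_eq : ∀ (hmem : (∑ v ∈ t, c v • primeCycle v) ∈ cyclesOfDim (quadricCubic Q C).left 1) (k : ℤ),
      k • ChowGroup.mk (quadricCubic Q C).left 1 ⟨∑ v ∈ t, c v • primeCycle v, hmem⟩ =
        ∑ v ∈ t.attach, (k * c v) • ChowGroup.ofPoint (v : ↥(quadricCubic Q C).left) (ht v v.2).1.height_eq := by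
    intro hmem k
    have e : (⟨∑ v ∈ t, c v • primeCycle v, hmem⟩ : ↥(cyclesOfDim (quadricCubic Q C).left 1)) =
        ∑ v ∈ t.attach, c v • ⟨primeCycle (v : ↥(quadricCubic Q C).left), (ht v v.2).1.primeCycle_mem⟩ := by
      apply Subtype.ext
      rw [AddSubgroup.val_finsetSum]
      simp only [AddSubgroup.coe_zsmul]
      exact (Finset.sum_attach t (fun v => c v • primeCycle v)).symm
    rw [e, map_sum, Finset.smul_sum]
    refine Finset.sum_congr rfl fun v _ => ?_
    rw [map_zsmul, smul_smul]
    rfl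
  by_cases hη2 : height (f η) = 1 + 1
  · -- `π(S)` is a surface: the Gysin term
    have hHmPI1 : cycleRestrictClosed i HmPI ∈ cyclesOfDim (quadricCubic Q C).left 1 :=
      cycleRestrictClosed_mem_cyclesOfDim i (CartierDivisor.primeInter_mem_cyclesOfDim (X := quadric Q) _ hη2)
    have hR : ChowGroup.mk (quadricCubic Q C).left 1 ⟨_, sub_mem (sub_mem (AddSubgroup.zsmul_mem _ hpw N)
        (AddSubgroup.zsmul_mem _ hHmPI1 m)) hsum_mem⟩ = 0 := ChowGroup.mk_eq_zero_iff.mpr hres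
    have hG := quadricCubicGysin_mk_primeCycle_eq_smul_of_closure_subset (by norm_num : 0 < 3) hC hC0 hCη (d := 1)
      hη2 (𝔏.closure_quadricι_πq_subset η) 𝔏.mK_mem 𝔏.mK_ne_zero 𝔏.formDivisor_mK_avoids_genericPoint
      (𝔏.mK_notMem_πq_genericPoint)
    -- rewrite the vanishing class
    have hR' : N • ChowGroup.ofPoint w hw - m • ChowGroup.mk (quadricCubic Q C).left 1 ⟨_, hHmPI1⟩ -
        ChowGroup.mk (quadricCubic Q C).left 1 ⟨_, hsum_mem⟩ = 0 := by
      rw [← hR, ChowGroup.ofPoint]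
      rw [← map_zsmul, ← map_zsmul, ← map_sub, ← map_sub]
      rfl
    have hG' : (3 : ℤ) • ChowGroup.mk (quadricCubic Q C).left 1 ⟨_, hHmPI1⟩ =
        quadricCubicGysin (by norm_num : 0 < 3) hC hC0 hCη 1
          (ChowGroup.mk (quadric Q).left (1 + 1) ⟨primeCycle (f η), primeCycle_mem_cyclesOfDim hη2⟩) := by
      have h := hG.symm
      exact_mod_cast h
    have e1 : N • ChowGroup.ofPoint w hw = m • ChowGroup.mk (quadricCubic Q C).left 1 ⟨_, hHmPI1⟩ +
        ChowGroup.mk (quadricCubic Q C).left 1 ⟨_, hsum_mem⟩ := by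
      have h := hR'
      rw [sub_sub, sub_eq_zero] at h
      exact h
    refine ⟨3 * N, mul_ne_zero (by norm_num) hN,
      m • ChowGroup.mk (quadric Q).left (1 + 1) ⟨primeCycle (f η), primeCycle_mem_cyclesOfDim hη2⟩,
      t, ht, fun v => 3 * c v, ?_⟩
    beta_reduce
    rw [map_zsmul, ← hG', ← hsum_eq hsum_mem 3, mul_smul, e1, smul_add, smul_comm (3 : ℤ) m]
  · -- `π(S)` is not a surface: the Gysin term vanishes
    have hm0 : m = 0 := by
      have hne : height η ≠ height (f η) := by
        rw [height_genericPoint_surf_carrier w (𝔏.F' : Type u) 𝔏.lineData hw]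
        exact fun h => hη2 (by rw [← h]; rfl)
      rw [hm]
      unfold AlgebraicCycle.mapCoeff
      split_ifs with h'
      · exact absurd h' hne
      · rfl
    rw [hm0, zero_smul, sub_zero] at hres
    have hR : ChowGroup.mk (quadricCubic Q C).left 1 ⟨_, sub_mem (AddSubgroup.zsmul_mem _ hpw N) hsum_mem⟩ = 0 :=
      ChowGroup.mk_eq_zero_iff.mpr hres
    refine ⟨N, hN, 0, t, ht, c, ?_⟩
    rw [map_zero, zero_add]
    have hR' : N • ChowGroup.ofPoint w hw - ChowGroup.mk (quadricCubic Q C).left 1 ⟨_, hsum_mem⟩ = 0 := by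
      rw [← hR, ChowGroup.ofPoint, ← map_zsmul, ← map_sub]
      rfl
    rw [sub_eq_zero] at hR'
    rw [hR', ← one_smul ℤ (ChowGroup.mk _ 1 ⟨_, hsum_mem⟩), hsum_eq hsum_mem 1]
    simp

end GenericStrongLine


/-! ### The Main Theorem at `(8, 1, 2, (2, 3))` -/

/-- **Hirschowitz–Iyer 2010, Main Theorem (§1.6) at `(n, r, s, (d₁, d₂)) = (8, 1, 2, (2, 3))`**: for a
quadric `Q` and a cubic `C` on `ℙ⁸_ℂ` satisfying the Jacobian condition, if `CH₂(V₊(Q))` has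
`ℚ`-rank `≤ 1` then `CH₁(V₊(Q, C))` has `ℚ`-rank `≤ 1`. Assembled from the surjectivity theorem
for the pair (`quadricCubicGysin_qsurjective_of_curves`: Thm. 2.1 for `r = 1`), its two inputs —
Lemma 2.2 for `s = 0` (`GenericStrongLine.hcurve`, the ruled surface over the normalisation of the
curve) and the covering of `V₊(Q, C)` by strong lines (Prop. 6.1, `exists_isStrongLinePoint_of_isClosed`,
entering through `nonempty_genericStrongLine`) — and the reduction
`HirschowitzIyer2010_QCH1_quadricCubic_P8_of_gysin_surjective`.
[cite: HirschowitzIyer2010, Main Theorem of §1.6 via §1.4/§2 (Thm. 2.1, Lemma 2.2) and §6 Prop. 6.1] -/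
theorem HirschowitzIyer2010_QCH1_quadricCubic_P8_holds : HirschowitzIyer2010_QCH1_quadricCubic_P8 := by
  refine HirschowitzIyer2010_QCH1_quadricCubic_P8_of_gysin_surjective fun Q C hQ hC hJ => ?_
  haveI := isIntegral_quadric_left_of_isNonsingularSystem (n := 7) (by norm_num) hQ (by norm_num) hC hJ
  intro b
  refine quadricCubicGysin_qsurjective_of_curves (by norm_num : 0 < 3) hC (ne_zero_snd_of_isNonsingularSystem hQ hJ)
    (notMem_quadricι_genericPoint_of_isNonsingularSystem (by norm_num) hQ (by norm_num) hC hJ) ?_ b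
  intro w hw
  obtain ⟨𝔏⟩ := nonempty_genericStrongLine (K := ℂ) hQ hC w
  exact 𝔏.hcurve hC (ne_zero_snd_of_isNonsingularSystem hQ hJ)
    (notMem_quadricι_genericPoint_of_isNonsingularSystem (by norm_num) hQ (by norm_num) hC hJ) hQ hC hw

end Literature.AlgebraicGeometry.Motives

end
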